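import Summits.QuantumFields.BalabanUV.T4Continuum.Support.NE3ProductPathChartSlice
import Summits.QuantumFields.BalabanUV.T4Continuum.Support.NE3TopRadiusLetters
import Summits.QuantumFields.BalabanUV.T4Continuum.Support.NE3CovariantLineSumsError
import Summits.QuantumFields.BalabanUV.T4Continuum.Support.NE3QbarIterCovLiftPrep
import Summits.QuantumFields.BalabanUV.T4Continuum.Support.NE3RightInverseSolveLetters
import HarnessLib

/-!
# T⁴ programme, node NE3 — bookkeeping for the supplier over `sfClass` (file 1∕2 of «the `sfClass` END re-run with `hsupp` discharged»):
# monotonicity of `DecomposedRepT` in its sizes, `pdev ≤` small-field radius, convexity of `exp`, K6-Ξ's Poincaré line at a pair from ONE ε-line,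
# non-negativity of the lift's letter constants

Cell `pub-balaban-gaps` (YM blitz, track G2, seat `ne3`, unit `pub-balaban-gaps-ne3`; writer prover-pub-balaban-gaps-ne3-g4-0, 2026-08-23), census
`run/shared/lean/pub/pub-balaban-gaps/ne/NE3.md` §6 NEXT (1).  Pure real-number∕order bookkeeping used by `Spine/NE3/SupplierB8SfClass` (file 2∕2).

CONTENT (0 sorry, no `def`): `DecomposedRepT.mono_sizes` (`ν ≤ ν′`, `κ₁ ≤ κ₁′`, `κ₂ ≤ κ₂′`), `pdev_le_of_smallField`, `exp_mul_sub_one_le` (`e^{ty} − 1 ≤ t(e^y − 1)`, `0 ≤ t ≤ 1`),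
`psLine_of_levelSmall` (K6-Ξ's line `8d(M(d−1)(M−1)x)² + 2·card n·(4d²(M−1)²x + 16d·loopRad((prop1Radius)^[j] x))² ≤ 1∕2` at `M = L^{j+1}`, `M²x = ε` from
`LevelSmall d L j x` and the ε-line `8d((d−1)ε)² + 2·card n·((4d² + 16d·17(d+1)(d+4))ε)² ≤ 1∕2`, via `NE3TopRadiusLetters.loopRad_iterate_le_of_levelSmall`),
`liftLetters_nonneg` (the four letter constants `c₁…c₄` of `NormalPartB8Lift` at `θ_loc = thetaLoc·ε < 1` are `≥ 0`).

HONEST FRAMING.  Arithmetic on OUR letters; NOTHING of Bałaban's is proved; **NE3 is NOT proved**; spine PROVED 0∕9; finite T⁴ rung (B)+1 — NOT continuum YM on ℝ⁴, NOT infinite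
volume, NOT mass gap, NOT `BetaPertH`, NOT Clay.  PLACEMENT: `Summits/QuantumFields/BalabanUV/T4Continuum/Spine/NE3/`; imports accepted modules only.
-/

set_option autoImplicit false

open scoped BigOperators Matrix.Norms.L2Operator
open NormedSpace Finset

namespace Summit.QuantumFields.BalabanUV.T4Continuum.NE3.SupplierB8SfClassPrep

open Set
open Literature.MathematicalPhysics.QuantumFieldTheory.Balaban1983to89
open B7Prop1Explicit B7Prop2Explicit
open T4AveragingDeficitWall (IsSkewDir IsUnitaryCfg SmallField)
open AveragingDeficitMultiLevelPrep (LevelSmall)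
open AveragingDeficitTwoLevelPrep (prop1Radius)
open NE3EnergyWeightedShapes (energyNormW energyNormW_nonneg)
open NE3ProductPathChartSlice (DecomposedRepT)
open NE3QbarIterCovLiftPrep (liftC liftC_nonneg)
open NE3RightInverseSolveLetters (thetaLoc)
open SpreadLift (loopRad)
open NE3TopRadiusLetters (loopRad_iterate_le_of_levelSmall)
open NE3CovariantLineSumsError (iterate_prop1Radius_nonneg)

noncomputable section

variable {d : ℕ} {n : Type*} [Fintype n] [DecidableEq n]

/-! ## §1 Three bookkeeping lemmas -/

/-- `DecomposedRepT` is MONOTONE in its three sizes `ν, κ₁, κ₂` (they are upper bounds against non-negative quantities). [folklore] -/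
theorem DecomposedRepT.mono_sizes {𝒞 : ℕ → _root_.Set (Site d → Fin d → (Matrix n n ℂ)ˣ)} {L N k : ℕ}
    {V UA UB : Site d → Fin d → (Matrix n n ℂ)ˣ} {u : Site d → (Matrix n n ℂ)ˣ} {X Nn : Site d → Fin d → Matrix n n ℂ}
    {T : _root_.Set (Site d → Fin d → Matrix n n ℂ)} {α αN ν κ₁ κ₂ a ν' κ₁' κ₂' : ℝ}
    (h : DecomposedRepT 𝒞 L N k V UA UB u X Nn T α αN ν κ₁ κ₂ a) (hν : ν ≤ ν') (hκ₁ : κ₁ ≤ κ₁') (hκ₂ : κ₂ ≤ κ₂') :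
    DecomposedRepT 𝒞 L N k V UA UB u X Nn T α αN ν' κ₁' κ₂' a :=
  { h with
    nwN := h.nwN.trans (mul_le_mul_of_nonneg_right hν (energyNormW_nonneg _ _ _ _ _))
    curlN := h.curlN.trans (mul_le_mul_of_nonneg_right hκ₁ (sq_nonneg _))
    l1N := h.l1N.trans (mul_le_mul_of_nonneg_right hκ₂ (sq_nonneg _)) }

/-- The plaquette-deviation supremum of a small field: `SmallField V a`, `0 ≤ a` ⟹ `pdev V ≤ a` (the diagonal words `κ = κ` are trivial). [folklore] -/
theorem pdev_le_of_smallField {V : Site d → Fin d → (Matrix n n ℂ)ˣ} {a : ℝ} (ha : 0 ≤ a) (hV : SmallField V a) : pdev V ≤ a := by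
  unfold pdev
  refine Real.iSup_le (fun p => ?_) ha
  rcases eq_or_ne p.2.1 p.2.2 with h | h
  · have h1 : hol V p.1 (plaqWord p.2.1 p.2.2) = 1 := by
      rw [h, B7Prop1Local.hol_plaqWord_eq, mul_inv_cancel_right, mul_inv_cancel]
    rw [h1, Units.val_one, sub_self, norm_zero]
    exact ha
  · exact hV p.1 p.2.1 p.2.2 h

/-- Convexity of `exp` between `0` and `y`: for `0 ≤ t ≤ 1`, `exp (t·y) − 1 ≤ t·(exp y − 1)`. [folklore] -/
theorem exp_mul_sub_one_le {t y : ℝ} (ht0 : 0 ≤ t) (ht1 : t ≤ 1) : Real.exp (t * y) - 1 ≤ t * (Real.exp y - 1) := by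
  have h := convexOn_exp.2 (Set.mem_univ (0:ℝ)) (Set.mem_univ y) (by linarith : 0 ≤ 1 - t) ht0 (by ring)
  simp only [smul_eq_mul, mul_zero, zero_add, Real.exp_zero, mul_one] at h
  linarith

/-! ## §2 K6-Ξ's Poincaré line at a pair from one ε-line -/

omit [DecidableEq n] in
/-- **K6-Ξ's POINCARÉ LINE AT THE PAIR FROM ONE ε-LINE** (`3 ≤ d`, `2 ≤ L`, `M = L^{j+1}`, `0 ≤ x`, `M²x = ε`, `LevelSmall d L j x`):
`8d(M((d−1)(M−1)x))² + 2·card n·(4d²(M−1)²x + 16d·loopRad d L ((prop1Radius d L)^[j] x))² ≤ 1∕2` from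
`8d((d−1)ε)² + 2·card n·((4d² + 16d·17(d+1)(d+4))ε)² ≤ 1∕2` (`loopRad((prop1Radius)^[j] x) ≤ 17(d+1)(d+4)·M²x`). [folklore] -/
theorem psLine_of_levelSmall [Nonempty n] (hd : 3 ≤ d) {L : ℕ} (hL : 2 ≤ L) (j : ℕ) {x ε : ℝ} (hx0 : 0 ≤ x)
    (hMx : ((L : ℝ) ^ (j + 1)) ^ 2 * x = ε) (hsj : LevelSmall d L j x)
    (hPsε : 8 * d * (((d : ℝ) - 1) * ε) ^ 2
      + 2 * (Fintype.card n * ((4 * (d : ℝ) ^ 2 + 16 * d * (17 * (((d : ℝ) + 1) * ((d : ℝ) + 4)))) * ε) ^ 2) ≤ 1 / 2) :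
    8 * d * (((L : ℝ) ^ (j + 1)) * (((d : ℝ) - 1) * (((L : ℝ) ^ (j + 1)) - 1) * x)) ^ 2
      + 2 * (Fintype.card n * (4 * (d : ℝ) ^ 2 * ((L : ℝ) ^ (j + 1) - 1) ^ 2 * x + 16 * d * loopRad d L ((prop1Radius d L)^[j] x)) ^ 2)
        ≤ 1 / 2 := by
  have hL0 : (0 : ℝ) < L := by exact_mod_cast (show 0 < L by omega)
  have hd0 : (1 : ℝ) ≤ d := by exact_mod_cast (show 1 ≤ d by omega)
  set M : ℝ := (L : ℝ) ^ (j + 1) with hM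
  have hM0 : 0 < M := by rw [hM]; exact pow_pos hL0 _
  have hM1 : 1 ≤ M := by rw [hM]; exact one_le_pow₀ (by exact_mod_cast (show 1 ≤ L by omega))
  have hl := loopRad_iterate_le_of_levelSmall hL j hx0 hsj
  rw [← hM, hMx] at hl
  have hdm : 0 ≤ (d : ℝ) - 1 := by linarith only [hd0]
  have hM1' : 0 ≤ M - 1 := by linarith only [hM1]
  have hMM : M * (M - 1) * x ≤ ε := by
    rw [← hMx]
    refine mul_le_mul_of_nonneg_right ?_ hx0
    rw [sq]
    exact mul_le_mul_of_nonneg_left (by linarith only [hM0]) hM0.le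
  have e1 : M * (((d : ℝ) - 1) * (M - 1) * x) ≤ ((d : ℝ) - 1) * ε := by
    have e : M * (((d : ℝ) - 1) * (M - 1) * x) = ((d : ℝ) - 1) * (M * (M - 1) * x) := by ring
    rw [e]
    exact mul_le_mul_of_nonneg_left hMM hdm
  have e1' : 0 ≤ M * (((d : ℝ) - 1) * (M - 1) * x) :=
    mul_nonneg hM0.le (mul_nonneg (mul_nonneg hdm hM1') hx0)
  have e2 : 4 * (d : ℝ) ^ 2 * (M - 1) ^ 2 * x ≤ 4 * (d : ℝ) ^ 2 * ε := by
    rw [← hMx]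
    have hp : (M - 1) ^ 2 ≤ M ^ 2 := pow_le_pow_left₀ hM1' (by linarith only [hM0]) 2
    have hpx : (M - 1) ^ 2 * x ≤ M ^ 2 * x := mul_le_mul_of_nonneg_right hp hx0
    calc 4 * (d : ℝ) ^ 2 * (M - 1) ^ 2 * x = 4 * (d : ℝ) ^ 2 * ((M - 1) ^ 2 * x) := by ring
      _ ≤ 4 * (d : ℝ) ^ 2 * (M ^ 2 * x) := mul_le_mul_of_nonneg_left hpx (by positivity)
  have hlr0 : 0 ≤ loopRad d L ((prop1Radius d L)^[j] x) := by
    have := iterate_prop1Radius_nonneg (d := d) (L := L) j hx0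
    unfold loopRad
    positivity
  have e3 : 4 * (d : ℝ) ^ 2 * (M - 1) ^ 2 * x + 16 * d * loopRad d L ((prop1Radius d L)^[j] x)
      ≤ (4 * (d : ℝ) ^ 2 + 16 * d * (17 * (((d : ℝ) + 1) * ((d : ℝ) + 4)))) * ε := by
    have h16 := mul_le_mul_of_nonneg_left hl (by positivity : (0 : ℝ) ≤ 16 * d)
    have e : (4 * (d : ℝ) ^ 2 + 16 * d * (17 * (((d : ℝ) + 1) * ((d : ℝ) + 4)))) * ε
        = 4 * (d : ℝ) ^ 2 * ε + 16 * d * (17 * (((d : ℝ) + 1) * ((d : ℝ) + 4)) * ε) := by ring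
    rw [e]
    exact add_le_add e2 h16
  have e3' : 0 ≤ 4 * (d : ℝ) ^ 2 * (M - 1) ^ 2 * x + 16 * d * loopRad d L ((prop1Radius d L)^[j] x) := by
    have : 0 ≤ 4 * (d : ℝ) ^ 2 * (M - 1) ^ 2 * x := by positivity
    positivity
  have sq1 := pow_le_pow_left₀ e1' e1 2
  have sq2 := pow_le_pow_left₀ e3' e3 2
  have hd8 : (0 : ℝ) ≤ 8 * d := by positivity
  have t1 := mul_le_mul_of_nonneg_left sq1 hd8
  have t2 := mul_le_mul_of_nonneg_left sq2 (by positivity : (0 : ℝ) ≤ Fintype.card n)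
  linarith only [t1, t2, hPsε]

/-! ## §3 The lift's letter constants are non-negative -/

/-- The four letter constants `c₁…c₄` of `NormalPartB8Lift.exists_landauNormalPart_lift` at `θ_loc = thetaLoc·ε < 1` are non-negative. [folklore] -/
theorem liftLetters_nonneg (d : ℕ) (n : Type*) [Fintype n] {L N : ℕ} {ε : ℝ} (hql : 0 < 1 - thetaLoc d L * ε) :
    (0 : ℝ) ≤ 2 * (liftC d / (1 - thetaLoc d L * ε)) ^ 2
        + 8 * Fintype.card n * ((d : ℝ) * liftC d ^ 2 * (2 * (d : ℝ) + 8) ^ 2 / (1 - thetaLoc d L * ε) ^ 2) ∧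
    (0 : ℝ) ≤ 2 * (4 * d * (liftC d * (17 + 16 * (d : ℝ))) ^ 2 / (1 - thetaLoc d L * ε) ^ 2)
        + 128 * Fintype.card (T4AveragingDeficitWall.Plane d) * Fintype.card n
          * ((d : ℝ) * liftC d ^ 2 * (2 * (d : ℝ) + 8) ^ 2 / (1 - thetaLoc d L * ε) ^ 2) ∧
    (0 : ℝ) ≤ 2 * d * (liftC d * (17 + 16 * (d : ℝ))) / (1 - thetaLoc d L * ε)
        + 8 * Fintype.card (T4AveragingDeficitWall.Plane d)
          * Real.sqrt (Fintype.card n * ((d : ℝ) * liftC d ^ 2 * (2 * (d : ℝ) + 8) ^ 2 / (1 - thetaLoc d L * ε) ^ 2) * (N : ℝ) ^ d) ∧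
    (0 : ℝ) ≤ liftC d / (1 - thetaLoc d L * ε)
        + 2 * Real.sqrt ((d : ℝ) * Fintype.card n * ((d : ℝ) * liftC d ^ 2 * (2 * (d : ℝ) + 8) ^ 2 / (1 - thetaLoc d L * ε) ^ 2) * (N : ℝ) ^ d) := by
  have hlC := liftC_nonneg d
  have hcV : (0 : ℝ) ≤ (d : ℝ) * liftC d ^ 2 * (2 * (d : ℝ) + 8) ^ 2 / (1 - thetaLoc d L * ε) ^ 2 :=
    div_nonneg (by positivity) (sq_nonneg _)
  have hcn : (0 : ℝ) ≤ Fintype.card n := by positivity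
  have hcP : (0 : ℝ) ≤ Fintype.card (T4AveragingDeficitWall.Plane d) := by positivity
  have hdR : (0 : ℝ) ≤ d := by positivity
  have h2R : (0 : ℝ) ≤ 2 := by norm_num
  have h4R : (0 : ℝ) ≤ 4 := by norm_num
  have h8R : (0 : ℝ) ≤ 8 := by norm_num
  have h128R : (0 : ℝ) ≤ 128 := by norm_num
  have h17 : (0 : ℝ) ≤ 17 + 16 * (d : ℝ) := by positivity
  have hlq : 0 ≤ liftC d / (1 - thetaLoc d L * ε) := div_nonneg hlC hql.le
  have hlq2 : 0 ≤ (liftC d / (1 - thetaLoc d L * ε)) ^ 2 := sq_nonneg _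
  have hsqA : 0 ≤ 4 * d * (liftC d * (17 + 16 * (d : ℝ))) ^ 2 / (1 - thetaLoc d L * ε) ^ 2 :=
    div_nonneg (mul_nonneg (mul_nonneg h4R hdR) (sq_nonneg _)) (sq_nonneg _)
  have hlB : 0 ≤ 2 * d * (liftC d * (17 + 16 * (d : ℝ))) / (1 - thetaLoc d L * ε) :=
    div_nonneg (mul_nonneg (mul_nonneg h2R hdR) (mul_nonneg hlC h17)) hql.le
  have hsq1 : 0 ≤ Real.sqrt (Fintype.card n * ((d : ℝ) * liftC d ^ 2 * (2 * (d : ℝ) + 8) ^ 2 / (1 - thetaLoc d L * ε) ^ 2) * (N : ℝ) ^ d) :=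
    Real.sqrt_nonneg _
  have hsq2 : 0 ≤ Real.sqrt ((d : ℝ) * Fintype.card n * ((d : ℝ) * liftC d ^ 2 * (2 * (d : ℝ) + 8) ^ 2 / (1 - thetaLoc d L * ε) ^ 2) * (N : ℝ) ^ d) :=
    Real.sqrt_nonneg _
  exact ⟨add_nonneg (mul_nonneg h2R hlq2) (mul_nonneg (mul_nonneg h8R hcn) hcV),
    add_nonneg (mul_nonneg h2R hsqA) (mul_nonneg (mul_nonneg (mul_nonneg h128R hcP) hcn) hcV),
    add_nonneg hlB (mul_nonneg (mul_nonneg h8R hcP) hsq1),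
    add_nonneg hlq (mul_nonneg h2R hsq2)⟩

end

end Summit.QuantumFields.BalabanUV.T4Continuum.NE3.SupplierB8SfClassPrep
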